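import Literature.AlgebraicGeometry.Shioda1982.ExceptionalQuadruplesComplete
import HarnessLib

/-!
# Shioda 1982 / Meyer–Neutsch 1981: no exceptional quadruple at the level `N = 324` — kernel sweep, part 3 of 4

Topic `Literature/AlgebraicGeometry/Shioda1982`; companion of `ExceptionalQuadruplesComplete.lean` (search `checkB`, soundness
`tabelleOneCompleteAt_of_chunks`, invariant form `exists_mem_reps_of_isExceptionalQuadruple`, statement `TabelleOneCompleteAt`; sources,
method and framing in its module docstring) and of the series `ExceptionalQuadruplesSweep*.lean` (together: every level `2 ≤ N ≤ 180`
that is not a row of Tabelle 1; `…SweepTwoHundredTwenty/…TwoHundredSixty/…ThreeHundredForty.lean`,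
`…SweepTwoHundredFiftyTwo/…ThreeHundredNinetySix/…FourHundredSixtyEight.lean`, `…SweepTwoHundred.lean`: the levels `220, 260, 340`, `252, 396, 468`
and `200` of the families `20p`, `36p`, `40p`). THEOREMS only (no definition, no named fact): the same kernel
search at the single level `N = 324`, which carries NO row of [MeyerNeutsch1981Fermatquadrupel, Tabelle 1] (computer-generated there,
"alle Fermatquadrupel für N ≤ 614 ermittelt", §2 p. 53) and lies above the range `N ≤ 180` of Shioda's table p. 727 — by Aoki's
Theorem C ([Aoki1983], computer-assisted for `181 ≤ m ≤ 672`) there is no exceptional element at any level `> 180`; the files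
`ExceptionalQuadruplesSweepThreeHundredTwentyFourPartOne.lean`, `ExceptionalQuadruplesSweepThreeHundredTwentyFourPartTwo.lean`, `ExceptionalQuadruplesSweepThreeHundredTwentyFourPartThree.lean`, `ExceptionalQuadruplesSweepThreeHundredTwentyFour.lean` make the instance `N = 324` a kernel statement. The search at
`N = 324` visits 957933 candidate triples (`φ(324) − 1 = 107` units each), too many for one elaboration of bounded wall time, so the
chunks of first entries are spread over 4 files: `ExceptionalQuadruplesSweepThreeHundredTwentyFourPartOne.lean` — first entries `0 ≤ a < 25` (230706 candidates);
`ExceptionalQuadruplesSweepThreeHundredTwentyFourPartTwo.lean` — first entries `25 ≤ a < 51` (246214 candidates);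
`ExceptionalQuadruplesSweepThreeHundredTwentyFourPartThree.lean` — first entries `51 ≤ a < 79` (235817 candidates);
`ExceptionalQuadruplesSweepThreeHundredTwentyFour.lean` — first entries `79 ≤ a < 324` (245196 candidates); the last one assembles
`completeAt_threeHundredTwentyFour` (every sorted pair-free primitive Hodge 4-multiset mod `324` is standard) and `not_isExceptionalQuadruple_threeHundredTwentyFour`.
WHY THIS LEVEL (cell `pub-hfermat`): `324 = 2²·3⁴`: the tree's character-sum families cover the levels `K·p`, `p` a prime above a bound depending on `K`, for
`K ∈ {2, 3, 4, 6, 8, 9, 10, 12, 18, 20, 24, 36, 40}` or `K` a power of `2` or of `3` (`PicardNumber<K>Prime.lean`, `PicardNumberTwoPowerPrime.lean`,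
`PicardNumberThreePowPrime.lean`) and the prime-power levels (`PicardNumberPrimePower.lean`); writing `324 = K·p` with `p` prime forces
`K ∈ {108, 162}`, none of them among those `K`. `decide +kernel` only (no `native_decide`).

HONEST FRAMING (cell `pub-hfermat`): explicit algebraic cycles for specific Hodge classes on Fermat/Delsarte varieties; residual open
instances listed; no claim on general Hodge. These classes are algebraic (Lefschetz (1,1)); certified here is only the emptiness of the
exceptional list at this level.

## References
* [MeyerNeutsch1981Fermatquadrupel] W. Meyer, W. Neutsch, *Fermatquadrupel*, Math. Ann. 256 (1981) 51–62, §2 p. 53, Tabelle 1 p. 54 (no row 324).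
* [Shioda1982PicardFermat] T. Shioda, J. Fac. Sci. Univ. Tokyo IA 28 (1982) 725–734, table p. 727 (levels `≤ 180`), Prop. 4 (Q′) p. 729.
* [Aoki1983] N. Aoki, Math. Ann. 266 (1983) 23–54, Thm. C.
-/

namespace Literature.AlgebraicGeometry.Shioda1982

open Literature.AlgebraicGeometry.HodgeTheory

set_option maxHeartbeats 0 in
/-- **The search at `N = 324` passes on the first entries `51 ≤ a < 79`** (part 3 of 4: 16 chunks, 235817 candidate
triples): every visited sorted quadruple of representatives there fails the Hodge test or is standard (`checkB`; `reps 324 = []`).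
[cite: MeyerNeutsch1981Fermatquadrupel, §2 p. 53 ("alle Fermatquadrupel für N ≤ 614 ermittelt") and Tabelle 1 p. 54 (no row 324)]
[cite: Aoki1983, Thm. C] -/
theorem checkB_threeHundredTwentyFour_partThree :
    ∀ p ∈ ([(51, 1), (52, 1), (53, 1), (54, 1), (55, 2), (57, 2), (59, 2), (61, 2), (63, 2), (65, 2), (67, 2), (69, 2), (71, 2), (73, 2), (75, 2), (77, 2)] : List (ℕ × ℕ)), checkB 324 p.1 p.2 = true := by
  intro p hp
  simp only [List.mem_cons, List.not_mem_nil, or_false] at hp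
  rcases hp with rfl | rfl | rfl | rfl | rfl | rfl | rfl | rfl | rfl | rfl | rfl | rfl | rfl | rfl | rfl | rfl <;> decide +kernel

end Literature.AlgebraicGeometry.Shioda1982
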